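import Summits.QuantumAdvantage.AdviceFreeQNC0.CleanGapStrategies
import Summits.QuantumAdvantage.AdviceFreeQNC0.EliminationHardness
import HarnessLib

/-!
# Cell qa-qnc0 (rung F-Q1, route RingFrame, crux α `RingToElim`): the LOW-DEGREE GAP THEOREM —
# a polylog-degree walk strategy that does not BET inside one polylog window is an eliminator

Crux α (`RingHardU`, tree `ringWinU`): `u ∈ {0,1}ⁿ`, positions `g = 0..n`, selectors `y_g(u)`
of degree `≤ (log₂ n)^C`, `WIN(u) ⟺ #{g : y_g(u) ∧ c + g + |u| + W_g(u) ≢ 0 (mod 3)}` odd.  The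
gap lemma `ringWinU_cleanGap_le` (`CleanGapStrategies.lean`) bounds strategies that neither bet
inside a window of `ℓ` input bits nor READ them.  Here reading is allowed, for low degree.

Write `u = a ++ v ++ b` (`|v| = ℓ`, `glue3`) and suppose only `y_g ≡ 0` for `p < g < p + ℓ`.
Condition on `(a, b)`: a selected `g ≤ p` has character `A_g + |v|`, a selected `g ≥ p + ℓ` has
character `C_g + 2|v|` (`gapChar`), so `WIN(a ++ v ++ b) = P_{|v| mod 3}(v)` with
`P_r(v) = [N(v; r) odd]`, `N(v; r) = #{g : y_g(a ++ v ++ b) ∧ gapChar(g, r) ≢ 0}`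
(`readGapCount`).  (i) `N(v;0) + N(v;1) + N(v;2) = 2·#selected`, so `(P_0, P_1, P_2)(v)` is `000`
(a sure loss) or has exactly ONE losing residue; (ii) as a function of `v`, `P_r` is the parity
of a FIXED sub-family of the restricted selectors `v ↦ y_g(a ++ v ++ b)`, hence of the degree `D`
of the strategy (`hasDeg_append_left/right`, `hasDeg_parity`; no decoding products).  So each
fibre strategy is the two-bit eliminator `(P_1, P_2)` with decoder `11 ↦ 0, 01 ↦ 1, 10 ↦ 2`
(`gapDec`), and elimination hardness on the WINDOW cube (`elimSqrtDec`, degree `≤ c₀√ℓ`, from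
Srinivasan's robust Hegedűs lemma via the β-chain) plus Fubini give:

* `ringWinU_readGap_le_of_elim` — the fibre argument against an abstract elimination premise;
* `ringWinU_lowDegGap_sqrt_le` — **a walk strategy of degree `D ≤ c₀√ℓ` selecting no position
  strictly inside some window of `ℓ ≥ ℓ₀` input bits wins on at most `(1 − η₀)·2ⁿ` inputs**;
* `ringWinU_lowDegGap_le` — polylog form: degree `≤ (log₂ n)^C`, one clean run of
  `(log₂ n)^{2C+1}` consecutive unselected positions, `θ = 1 − η₀` for every `C`;
* `ringWinU_windows_uniform_le` — the `t`-window ladder (`ringWinU_windows_polylog_le`, whose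
  `θ_t = 1 − η_{t+1} → 1`) with ONE `θ` FOR ALL `t`: the run between the last interior window and
  the right-end window is clean; the other blocks play no role.

So α (`RingHardU`) is reduced to EVERYWHERE-DENSE strategies (a bet inside every run of
`(log₂ n)^{2C+1}` positions); `ringWinU_endSupported_le` is the case "window = the interior".
The cell's statement (prover qn-prover-3, 2026-08-26); not in print.
WHAT THIS IS NOT: nothing on everywhere-dense strategies (= α proper); `η₀` is Srinivasan's, not
the sharp `1/3`; no claim on `LDMAPolylog`, `TRPlus`; no separation.

## References

* S. Srinivasan, *A robust version of Hegedűs's lemma, with applications*, TheoretiCS 2 (2023),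
  Lemma 3.1 [Srinivasan2023] (through `elimSqrtDec_of_lowDegAvoidMod3Sparse`).
-/

noncomputable section

namespace Summit.QuantumAdvantage.AdviceFreeQNC0

open Finset
open Literature.Computability.MetaComplexity Literature.Computability.MetaComplexity.Smolensky

variable {p ℓ q : ℕ}

/-! ### The counts with the window weight as a parameter, selectors read at the true input -/

/-- `N(a, v, b; r)`: the number of positions selected AT THE TRUE INPUT `a ++ v ++ b` whose walk
character, with the window weight `|v|` replaced by the parameter `r`, is non-zero mod `3`
(compare `gapCount`, where the selectors are read off the outside blocks only). -/
def readGapCount (y : Fin (p + ℓ + q + 1) → (Fin (p + ℓ + q) → Bool) → Bool) (c : ℕ)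
    (a : Fin p → Bool) (v : Fin ℓ → Bool) (b : Fin q → Bool) (r : ℕ) : ℕ :=
  (univ.filter fun g : Fin (p + ℓ + q + 1) =>
    y g (glue3 a v b) = true ∧ gapChar ℓ c a b g.val r % 3 ≠ 0).card

/-- `N(a, v, b; r)` depends on `r` only mod `3`. -/
theorem readGapCount_mod (y : Fin (p + ℓ + q + 1) → (Fin (p + ℓ + q) → Bool) → Bool) (c : ℕ)
    (a : Fin p → Bool) (v : Fin ℓ → Bool) (b : Fin q → Bool) (r : ℕ) :
    readGapCount y c a v b r = readGapCount y c a v b (r % 3) :=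
  congrArg Finset.card (Finset.filter_congr fun g _ => by rw [gapChar_mod ℓ c a b g.val r])

variable (c : ℕ) (y : Fin (p + ℓ + q + 1) → (Fin (p + ℓ + q) → Bool) → Bool)

/-- **The win bit through the window weight (reading allowed).**  If the strategy never selects
a position strictly inside the window `(p, p + ℓ)`, then on `a ++ v ++ b` it wins iff
`N(a, v, b; |v|)` is odd. -/
theorem ringWinU_glue3_iff_readGapCount
    (hgap : ∀ g : Fin (p + ℓ + q + 1), p < g.val → g.val < p + ℓ → ∀ w, y g w = false)
    (a : Fin p → Bool) (v : Fin ℓ → Bool) (b : Fin q → Bool) :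
    ringWinU c y (glue3 a v b) = true ↔ readGapCount y c a v b (wt v) % 2 = 1 := by
  unfold ringWinU readGapCount
  rw [decide_eq_true_iff]
  have hset : (univ.filter fun g : Fin (p + ℓ + q + 1) =>
      y g (glue3 a v b) = true ∧ (c + g.val + walkExp (glue3 a v b) g.val) % 3 ≠ 0) =
      univ.filter fun g : Fin (p + ℓ + q + 1) =>
        y g (glue3 a v b) = true ∧ gapChar ℓ c a b g.val (wt v) % 3 ≠ 0 := by
    refine Finset.filter_congr fun g _ => ?_
    -- a selected position lies outside the open window
    have hout : y g (glue3 a v b) = true → (g.val ≤ p ∨ p + ℓ ≤ g.val) := by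
      intro h1
      by_contra hcon
      have hf := hgap g (by omega) (by omega) (glue3 a v b)
      rw [hf] at h1
      exact Bool.false_ne_true h1
    -- outside the open window the true character is `gapChar` at `r = |v|`
    have hchar : (g.val ≤ p ∨ p + ℓ ≤ g.val) →
        c + g.val + walkExp (glue3 a v b) g.val = gapChar ℓ c a b g.val (wt v) := by
      intro hg
      unfold walkExp gapChar
      by_cases hle : g.val ≤ p
      · rw [if_pos hle, wtPrefix_glue3_of_le a v b hle, wt_glue3]
      · rw [if_neg hle, wtPrefix_glue3_of_ge a v b (hg.resolve_left hle), wt_glue3]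
    constructor
    · rintro ⟨h1, h2⟩
      exact ⟨h1, by rwa [← hchar (hout h1)]⟩
    · rintro ⟨h1, h2⟩
      exact ⟨h1, by rwa [hchar (hout h1)]⟩
  rw [hset]

/-! ### The parity obstruction -/

/-- `N(0) + N(1) + N(2) = 2·#selected` (every selected position is counted for exactly two
residues), so the three parity bits have an even number of ones. -/
theorem readGapCount_sum_even (a : Fin p → Bool) (v : Fin ℓ → Bool) (b : Fin q → Bool) :
    (readGapCount y c a v b 0 + readGapCount y c a v b 1 + readGapCount y c a v b 2) % 2 = 0 := by
  set S := univ.filter fun g : Fin (p + ℓ + q + 1) => y g (glue3 a v b) = true with hS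
  have hcount : ∀ r, readGapCount y c a v b r =
      ∑ g ∈ S, (if gapChar ℓ c a b g.val r % 3 ≠ 0 then 1 else 0) := by
    intro r
    unfold readGapCount
    rw [hS, Finset.sum_filter, Finset.card_filter]
    refine Finset.sum_congr rfl fun g _ => ?_
    by_cases h1 : y g (glue3 a v b) = true <;>
      by_cases h2 : gapChar ℓ c a b g.val r % 3 ≠ 0 <;> simp [h1, h2]
  have h : ∑ r ∈ range 3, readGapCount y c a v b r = S.card * 2 := by
    simp_rw [hcount]
    rw [Finset.sum_comm, Finset.sum_congr rfl fun g _ => sum_range_three_gapChar_ne ℓ c a b g.val,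
      Finset.sum_const, smul_eq_mul]
  rw [Finset.sum_range_succ, Finset.sum_range_succ, Finset.sum_range_succ, Finset.sum_range_zero,
    zero_add] at h
  omega

/-! ### The parity bits as low-degree functions of the window content -/

/-- The parity bit `P_r(v) = [N(a, v, b; r) odd]` as a Boolean function of the window content. -/
def gapParity (a : Fin p → Bool) (b : Fin q → Bool) (r : ℕ) (v : Fin ℓ → Bool) : Bool :=
  decide (readGapCount y c a v b r % 2 = 1)

/-- **Degree of the parity bits.**  If every selector has degree `≤ D`, then every `P_r` has
degree `≤ D` on the window cube: it is the parity of the restricted selectors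
`v ↦ y_g(a ++ v ++ b)` over the fixed set of positions `g` with `gapChar(g, r) ≢ 0`. -/
theorem hasDeg_gapParity {D : ℕ} (hdeg : ∀ g, HasDeg (y g) D) (a : Fin p → Bool)
    (b : Fin q → Bool) (r : ℕ) : HasDeg (gapParity c y a b r) D := by
  -- restriction of each selector to the fibre keeps the degree
  have hres : ∀ g, HasDeg (fun v : Fin ℓ → Bool => y g (glue3 a v b)) D := by
    intro g
    have h1 : HasDeg (fun uv : Fin (p + ℓ) → Bool => y g (Fin.append uv b)) D :=
      hasDeg_append_left b (hdeg g)
    exact hasDeg_append_right a h1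
  -- the parity bit is the parity of a fixed sub-family of the restricted selectors
  have hN : ∀ v, readGapCount y c a v b r =
      ((((univ : Finset (Fin (p + ℓ + q + 1))).filter fun g =>
        gapChar ℓ c a b g.val r % 3 ≠ 0).filter fun g => y g (glue3 a v b) = true).card) := by
    intro v
    unfold readGapCount
    rw [Finset.filter_filter]
    exact congrArg Finset.card (Finset.filter_congr fun g _ => and_comm)
  have heq : gapParity c y a b r = fun v => decide
      (((((univ : Finset (Fin (p + ℓ + q + 1))).filter fun g =>
        gapChar ℓ c a b g.val r % 3 ≠ 0).filter fun g => y g (glue3 a v b) = true).card) % 2 = 1) := by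
    funext v
    simp only [gapParity, hN v]
  rw [heq]
  exact hasDeg_parity _ (fun g (v : Fin ℓ → Bool) => y g (glue3 a v b)) fun g _ => hres g

/-! ### The fibre eliminator -/

/-- The decoder of the fibre eliminator: from the bits `(P_1, P_2)`, the losing residue
(`11 ↦ 0`, `01 ↦ 1`, `10 ↦ 2`; `00 ↦ 0`, a fibre point where the strategy always loses). -/
def gapDec : ZMod 2 → ZMod 2 → ℕ := fun α β =>
  if α = 1 then (if β = 1 then 0 else 2) else (if β = 1 then 1 else 0)

/-- The decoder on Boolean bits. -/
theorem gapDec_bool (P₁ P₂ : Bool) :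
    gapDec (if P₁ = true then 1 else 0) (if P₂ = true then 1 else 0) =
      (if P₁ = true then (if P₂ = true then 0 else 2) else (if P₂ = true then 1 else 0)) := by
  cases P₁ <;> cases P₂ <;> simp [gapDec]

/-- **On a fibre, the winning window contents avoid the decoded residue**: if the strategy
selects no position strictly inside the window, then `WIN(a ++ v ++ b)` implies
`|v| mod 3 ≠ gapDec(P_1 v, P_2 v)`. -/
theorem win_subset_fibre
    (hgap : ∀ g : Fin (p + ℓ + q + 1), p < g.val → g.val < p + ℓ → ∀ w, y g w = false)
    (a : Fin p → Bool) (b : Fin q → Bool) :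
    (univ.filter fun v : Fin ℓ → Bool => ringWinU c y (glue3 a v b) = true) ⊆
      univ.filter fun v : Fin ℓ → Bool =>
        ¬ (gapDec (if gapParity c y a b 1 v = true then 1 else 0)
            (if gapParity c y a b 2 v = true then 1 else 0) % 3 = Hegedus.wt v % 3) := by
  intro v hv
  simp only [Finset.mem_filter, Finset.mem_univ, true_and] at hv ⊢
  rw [ringWinU_glue3_iff_readGapCount c y hgap, readGapCount_mod] at hv
  have hwt : Hegedus.wt v = wt v := rfl
  have heven := readGapCount_sum_even c y a v b
  -- the decoded residue as an arithmetic expression in the three counts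
  set E : ℕ := (if readGapCount y c a v b 1 % 2 = 1 then
      (if readGapCount y c a v b 2 % 2 = 1 then 0 else 2)
    else (if readGapCount y c a v b 2 % 2 = 1 then 1 else 0)) with hE
  have hdecE : gapDec (if gapParity c y a b 1 v = true then 1 else 0)
      (if gapParity c y a b 2 v = true then 1 else 0) = E := by
    rw [gapDec_bool]
    simp only [gapParity, decide_eq_true_eq, hE]
  have hE3 : E < 3 := by
    rw [hE]; split_ifs <;> omega
  -- the decoded residue never carries an odd count
  have key : ∀ r, r < 3 → readGapCount y c a v b r % 2 = 1 → E ≠ r := by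
    intro r hr hodd
    rw [hE]
    interval_cases r <;> split_ifs <;> omega
  rw [hdecE, Nat.mod_eq_of_lt hE3, hwt]
  exact key (wt v % 3) (Nat.mod_lt _ (by norm_num)) hv

/-- **The fibre bound.**  Under an elimination premise at `(ℓ, D)` (every degree-`≤ D` two-bit
eliminator on the `ℓ`-cube names the true residue on `≥ η₀·2^ℓ` points), a degree-`≤ D` strategy
with the clean window `(p, p + ℓ)` wins on at most `(1 − η₀)·2^ℓ` contents of every fibre. -/
theorem card_win_fibre_le {η₀ : ℝ} {D : ℕ}
    (hE : ∀ a b : CubeFn (ZMod 2) ℓ, a ∈ lowDeg (ZMod 2) ℓ D → b ∈ lowDeg (ZMod 2) ℓ D →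
      ∀ dec : ZMod 2 → ZMod 2 → ℕ, η₀ * (2 : ℝ) ^ ℓ ≤
        ((univ.filter fun u : Fin ℓ → Bool => dec (a u) (b u) % 3 = Hegedus.wt u % 3).card : ℝ))
    (hdeg : ∀ g, HasDeg (y g) D)
    (hgap : ∀ g : Fin (p + ℓ + q + 1), p < g.val → g.val < p + ℓ → ∀ w, y g w = false)
    (a : Fin p → Bool) (b : Fin q → Bool) :
    ((univ.filter fun v : Fin ℓ → Bool => ringWinU c y (glue3 a v b) = true).card : ℝ) ≤
      (1 - η₀) * (2 : ℝ) ^ ℓ := by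
  have hElim := hE (fun v => if gapParity c y a b 1 v = true then (1 : ZMod 2) else 0)
    (fun v => if gapParity c y a b 2 v = true then (1 : ZMod 2) else 0)
    (hasDeg_gapParity c y hdeg a b 1) (hasDeg_gapParity c y hdeg a b 2) gapDec
  set Good : (Fin ℓ → Bool) → Prop := fun v =>
    gapDec (if gapParity c y a b 1 v = true then 1 else 0)
      (if gapParity c y a b 2 v = true then 1 else 0) % 3 = Hegedus.wt v % 3 with hGood
  have hcard := Finset.card_le_card (win_subset_fibre c y hgap a b)
  have hcompl : (univ.filter fun v => Good v).card + (univ.filter fun v => ¬ Good v).card = 2 ^ ℓ := by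
    rw [Finset.card_filter_add_card_filter_not, Finset.card_univ, Fintype.card_fun,
      Fintype.card_bool, Fintype.card_fin]
  have hcardR : ((univ.filter fun v : Fin ℓ → Bool => ringWinU c y (glue3 a v b) = true).card : ℝ)
      ≤ ((univ.filter fun v => ¬ Good v).card : ℝ) := Nat.cast_le.mpr hcard
  have hcomplR : ((univ.filter fun v => Good v).card : ℝ) +
      ((univ.filter fun v => ¬ Good v).card : ℝ) = (2 : ℝ) ^ ℓ := by
    rw [← Nat.cast_add, hcompl]; norm_num
  have hElim' : η₀ * (2 : ℝ) ^ ℓ ≤ ((univ.filter fun v => Good v).card : ℝ) := hElim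
  linarith

/-! ### The low-degree gap theorem -/

/-- **The fibre argument, Fubini form.**  Under an elimination premise at `(ℓ, D)` with constant
`η₀`, every walk strategy of degree `≤ D` on `n = p + ℓ + q` bits that selects no position
strictly inside the window `(p, p + ℓ)` wins on at most `(1 − η₀)·2ⁿ` inputs (every charge). -/
theorem ringWinU_readGap_le_of_elim {η₀ : ℝ} {D : ℕ}
    (hE : ∀ a b : CubeFn (ZMod 2) ℓ, a ∈ lowDeg (ZMod 2) ℓ D → b ∈ lowDeg (ZMod 2) ℓ D →
      ∀ dec : ZMod 2 → ZMod 2 → ℕ, η₀ * (2 : ℝ) ^ ℓ ≤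
        ((univ.filter fun u : Fin ℓ → Bool => dec (a u) (b u) % 3 = Hegedus.wt u % 3).card : ℝ))
    (hdeg : ∀ g, HasDeg (y g) D)
    (hgap : ∀ g : Fin (p + ℓ + q + 1), p < g.val → g.val < p + ℓ → ∀ w, y g w = false) :
    ((univ.filter fun w : Fin (p + ℓ + q) → Bool => ringWinU c y w = true).card : ℝ) ≤
      (1 - η₀) * (2 : ℝ) ^ (p + ℓ + q) := by
  rw [card_filter_eq_sum_glue3]
  push_cast
  calc ∑ a : Fin p → Bool, ∑ b : Fin q → Bool,
        ((univ.filter fun v : Fin ℓ → Bool => ringWinU c y (glue3 a v b) = true).card : ℝ)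
      ≤ ∑ _a : Fin p → Bool, ∑ _b : Fin q → Bool, (1 - η₀) * (2 : ℝ) ^ ℓ :=
        Finset.sum_le_sum fun a _ => Finset.sum_le_sum fun b _ =>
          card_win_fibre_le c y hE hdeg hgap a b
    _ = (1 - η₀) * (2 : ℝ) ^ (p + ℓ + q) := by
        simp only [Finset.sum_const, Finset.card_univ, Fintype.card_fun, Fintype.card_bool,
          Fintype.card_fin, nsmul_eq_mul]
        push_cast
        ring

/-- **THE LOW-DEGREE GAP THEOREM (square-root form).**  There are `θ < 1`, `c₀ > 0` and `ℓ₀`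
(`θ = 1 − η₀` with the constants of the tree's two-bit elimination hardness `elimSqrtDec`, from
Srinivasan's robust Hegedűs lemma) such that: for all `p, ℓ, q` with `ℓ ≥ ℓ₀`, every degree
`D ≤ c₀·√ℓ`, every charge and every walk strategy on `p + ℓ + q` bits with all selectors of
degree `≤ D` that selects no position strictly inside the window `(p, p + ℓ)` — but may READ
every bit — the ring game in walk coordinates is won on at most `θ·2^{p+ℓ+q}` inputs.
(Cell statement; special case of crux α of route RingFrame.) [cite: Srinivasan2023, Lemma 3.1] -/
theorem ringWinU_lowDegGap_sqrt_le :
    ∃ θ : ℝ, θ < 1 ∧ ∃ c₀ : ℝ, 0 < c₀ ∧ ∃ ℓ₀ : ℕ, ∀ p ℓ q : ℕ, ℓ₀ ≤ ℓ →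
      ∀ D : ℕ, (D : ℝ) ≤ c₀ * Real.sqrt ℓ →
      ∀ c : ℕ, ∀ y : Fin (p + ℓ + q + 1) → (Fin (p + ℓ + q) → Bool) → Bool,
        (∀ g, HasDeg (y g) D) →
        (∀ g : Fin (p + ℓ + q + 1), p < g.val → g.val < p + ℓ → ∀ u, y g u = false) →
          ((univ.filter fun u : Fin (p + ℓ + q) → Bool => ringWinU c y u = true).card : ℝ) ≤
            θ * (2 : ℝ) ^ (p + ℓ + q) := by
  obtain ⟨η₀, hη₀, c₀, hc₀, ℓ₀, H⟩ := elimSqrtDec_of_lowDegAvoidMod3Sparse lowDegAvoidMod3Sparse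
  exact ⟨1 - η₀, by linarith, c₀, hc₀, ℓ₀, fun p ℓ q hℓ D hD c y hdeg hgap =>
    ringWinU_readGap_le_of_elim c y (fun a b ha hb dec => H ℓ hℓ D hD a b ha hb dec) hdeg hgap⟩

/-- **THE LOW-DEGREE GAP THEOREM (polylog form).**  There is `θ < 1` such that for every `C`
and all large `n`: every walk strategy on `n` bits with selectors of degree `≤ (log₂ n)^C` that
selects no position strictly inside some window `(p, p + ℓ)` of `ℓ ≥ (log₂ n)^{2C+1}` input
bits (`p + ℓ ≤ n`; the window may be read) wins the ring game in walk coordinates, for every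
charge, on at most `θ·2ⁿ` inputs.  One `θ = 1 − η₀` serves every `C`.  So crux α (`RingHardU`)
is reduced to strategies that bet inside EVERY run of `(log₂ n)^{2C+1}` consecutive positions.
(Cell statement; from `ringWinU_lowDegGap_sqrt_le`: `(log₂ n)^C ≤ c₀·√ℓ` once
`c₀²·log₂ n ≥ 1`.) [cite: Srinivasan2023, Lemma 3.1] -/
theorem ringWinU_lowDegGap_le :
    ∃ θ : ℝ, θ < 1 ∧ ∀ C : ℕ, ∃ n₀ : ℕ, ∀ n ≥ n₀, ∀ p ℓ : ℕ, p + ℓ ≤ n →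
      (Nat.log 2 n) ^ (2 * C + 1) ≤ ℓ → ∀ c : ℕ, ∀ y : Fin (n + 1) → (Fin n → Bool) → Bool,
        (∀ g, HasDeg (y g) ((Nat.log 2 n) ^ C)) →
        (∀ g : Fin (n + 1), p < g.val → g.val < p + ℓ → ∀ u, y g u = false) →
          ((univ.filter fun u : Fin n → Bool => ringWinU c y u = true).card : ℝ) ≤
            θ * (2 : ℝ) ^ n := by
  obtain ⟨θ, hθ, c₀, hc₀, ℓ₀, H⟩ := ringWinU_lowDegGap_sqrt_le
  refine ⟨θ, hθ, fun C => ⟨2 ^ (max (ℓ₀ + 1) (⌈1 / c₀ ^ 2⌉₊ + 1)), ?_⟩⟩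
  intro n hn p ℓ hpl hℓ c y hdeg hgap
  obtain ⟨q, rfl⟩ : ∃ q, n = p + ℓ + q := ⟨n - (p + ℓ), by omega⟩
  set k := Nat.log 2 (p + ℓ + q) with hk
  have hm : max (ℓ₀ + 1) (⌈1 / c₀ ^ 2⌉₊ + 1) ≤ k := Nat.le_log_of_pow_le one_lt_two hn
  have hkℓ : ℓ₀ + 1 ≤ k := le_trans (le_max_left _ _) hm
  have hk1 : ⌈1 / c₀ ^ 2⌉₊ + 1 ≤ k := le_trans (le_max_right _ _) hm
  -- the window is long enough for the elimination engine
  have hℓ₀ℓ : ℓ₀ ≤ ℓ := by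
    have : k ≤ k ^ (2 * C + 1) := Nat.le_self_pow (by omega) k
    omega
  -- `c₀ √k ≥ 1`
  have hck : 1 ≤ c₀ * Real.sqrt k := by
    have h2 : ((⌈1 / c₀ ^ 2⌉₊ : ℕ) : ℝ) + 1 ≤ k := by exact_mod_cast hk1
    have h3 : (1 / c₀ ^ 2 : ℝ) ≤ ((⌈1 / c₀ ^ 2⌉₊ : ℕ) : ℝ) := Nat.le_ceil _
    have h1 : (1 / c₀ ^ 2 : ℝ) ≤ k := by linarith
    rw [div_le_iff₀ (by positivity)] at h1
    calc (1 : ℝ) = Real.sqrt 1 := Real.sqrt_one.symm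
      _ ≤ Real.sqrt (c₀ ^ 2 * k) := Real.sqrt_le_sqrt (by linarith)
      _ = c₀ * Real.sqrt k := by rw [Real.sqrt_mul (by positivity), Real.sqrt_sq hc₀.le]
  -- `√ℓ ≥ k^C √k`
  have hsqrtℓ : (k : ℝ) ^ C * Real.sqrt k ≤ Real.sqrt ℓ := by
    have h2 : ((k ^ (2 * C + 1) : ℕ) : ℝ) ≤ ℓ := by exact_mod_cast hℓ
    have h1 : ((k : ℝ) ^ C) ^ 2 * k ≤ ℓ := by
      calc ((k : ℝ) ^ C) ^ 2 * k = (k : ℝ) ^ (2 * C + 1) := by ring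
        _ ≤ ℓ := by push_cast at h2; exact h2
    calc (k : ℝ) ^ C * Real.sqrt k = Real.sqrt (((k : ℝ) ^ C) ^ 2 * k) := by
          rw [Real.sqrt_mul (by positivity), Real.sqrt_sq (by positivity)]
      _ ≤ Real.sqrt ℓ := Real.sqrt_le_sqrt h1
  -- the degree budget `k^C ≤ c₀ √ℓ`
  have hD : ((k ^ C : ℕ) : ℝ) ≤ c₀ * Real.sqrt ℓ := by
    push_cast
    calc (k : ℝ) ^ C = (k : ℝ) ^ C * 1 := (mul_one _).symm
      _ ≤ (k : ℝ) ^ C * (c₀ * Real.sqrt k) := mul_le_mul_of_nonneg_left hck (by positivity)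
      _ = c₀ * ((k : ℝ) ^ C * Real.sqrt k) := by ring
      _ ≤ c₀ * Real.sqrt ℓ := mul_le_mul_of_nonneg_left hsqrtℓ hc₀.le
  exact H p ℓ q hℓ₀ℓ _ hD c y hdeg hgap

/-! ### Corollary: the window ladder with a `t`-uniform constant -/

/-- **The `t`-window ladder holds with ONE constant for all `t`.**  Same hypotheses as
`ringWinU_windows_polylog_le` (ends + `t` interior windows `[P_j, P_j + K)`, blocks
`≥ (log₂ n)^{2C+2}`, degree and `K ≤ (log₂ n)^C`; there `θ_t = 1 − η_{t+1} → 1`), with the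
quantifiers `∃ θ ∀ t`: the run of positions between the last interior window and the right-end
window is clean, so `ringWinU_lowDegGap_le` applies; the other blocks play no role.
[cite: Srinivasan2023, Lemma 3.1] -/
theorem ringWinU_windows_uniform_le :
    ∃ θ : ℝ, θ < 1 ∧ ∀ t C : ℕ, ∃ n₀ : ℕ, ∀ l : List ℕ, l.length = t + 1 →
      n₀ ≤ l.sum → (∀ L ∈ l, (Nat.log 2 l.sum) ^ (2 * C + 2) ≤ L) →
      ∀ K : ℕ, K ≤ (Nat.log 2 l.sum) ^ C → ∀ c : ℕ,
      ∀ y : Fin (l.sum + 1) → (Fin l.sum → Bool) → Bool,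
        (∀ g, HasDeg (y g) ((Nat.log 2 l.sum) ^ C)) →
        (∀ g : Fin (l.sum + 1),
            (∀ j < l.length, g.val < (l.take j).sum ∨ (l.take j).sum + K ≤ g.val) →
            g.val + K ≤ l.sum → ∀ u, y g u = false) →
          ((univ.filter fun u : Fin l.sum → Bool => ringWinU c y u = true).card : ℝ) ≤
            θ * (2 : ℝ) ^ l.sum := by
  obtain ⟨θ, hθ, hG⟩ := ringWinU_lowDegGap_le
  refine ⟨θ, hθ, fun t C => ?_⟩
  obtain ⟨n₀, hn₀⟩ := hG C
  refine ⟨max n₀ 4, fun l hl hn hblk K hK c y hdeg hsupp => ?_⟩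
  have hn₀n : n₀ ≤ l.sum := le_trans (le_max_left _ _) hn
  have hn4 : 4 ≤ l.sum := le_trans (le_max_right _ _) hn
  set k := Nat.log 2 l.sum with hk
  have hk2 : 2 ≤ k := Nat.le_log_of_pow_le (by norm_num) (by omega)
  -- the last anchor `P` and the last block `L`: `P + L = Σ l`, `L ≥ k^(2C+2)`
  set P := (l.take t).sum with hP
  have ht : t < l.length := by omega
  have hlast : P + l[t] = l.sum := by
    have h1 : l = l.take t ++ l.drop t := (List.take_append_drop t l).symm
    have h2 : l.drop t = l[t] :: l.drop (t + 1) := List.drop_eq_getElem_cons ht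
    have h3 : l.drop (t + 1) = [] := List.drop_of_length_le (by omega)
    conv_rhs => rw [h1, List.sum_append, h2, h3, List.sum_cons, List.sum_nil, add_zero]
  have hL : k ^ (2 * C + 2) ≤ l[t] := hblk _ (List.getElem_mem ht)
  -- the clean run: positions `P + K < g < P + K + k^(2C+1)`
  have hKk : K ≤ k ^ C := hK
  have hroom : K + k ^ (2 * C + 1) + K ≤ k ^ (2 * C + 2) := by
    have h1 : k ^ C ≤ k ^ (2 * C + 1) := Nat.pow_le_pow_right (by omega) (by omega)
    have h2 : k ^ (2 * C + 2) = k * k ^ (2 * C + 1) := by ring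
    have h3 : 2 * k ^ (2 * C + 1) ≤ k * k ^ (2 * C + 1) := Nat.mul_le_mul_right _ hk2
    have h4 : 2 * k ^ C ≤ k ^ (2 * C + 1) := by
      calc 2 * k ^ C ≤ k * k ^ C := Nat.mul_le_mul_right _ hk2
        _ = k ^ (C + 1) := by ring
        _ ≤ k ^ (2 * C + 1) := Nat.pow_le_pow_right (by omega) (by omega)
    omega
  have hpl : P + K + k ^ (2 * C + 1) ≤ l.sum := by omega
  have hgap : ∀ g : Fin (l.sum + 1), P + K < g.val → g.val < P + K + k ^ (2 * C + 1) →
      ∀ u, y g u = false := by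
    intro g hg1 hg2 u
    refine hsupp g (fun j hj => Or.inr ?_) (by omega) u
    have hPj : (l.take j).sum ≤ P := by
      rw [hP]
      exact List.monotone_sum_take l (by omega)
    omega
  exact hn₀ l.sum hn₀n (P + K) (k ^ (2 * C + 1)) hpl le_rfl c y hdeg hgap

end Summit.QuantumAdvantage.AdviceFreeQNC0
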